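import Summits.CriticalPhenomena.SAWScalingLimit.Theorems.SAWLeftRightFKGFKGToTraversalBoundCollarAssemblyWindow
import HarnessLib

/-!
# Sliding windows for collar structures, FIRST orientation (helper of stub `stub_collarAssembly`)

Crux `SAWLeftRightFKG.FKGToTraversalBound` (stmt-CriticalPhenomena-1878), line `gates-by-bubble-doors-by-fkg`,
registered helper `stub_collarWindowOut` of STUB 4 (`stub_collarAssembly`): the mirror image of
`stub_collarWindow` (file `…CollarAssemblyWindow.lean`) for the FIRST orientation of `CollarClauses` — the sites
joined to `a` off `V` touch `V` only INSIDE `r` and the sites joined to `H` off `V` touch `V` only BEYOND `R`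
(pockets with a small mouth near `z₀` and a large room far away: the neck-and-room family).  With
`U := Λ ∖ Near`, for every window `r + δ ≤ r'`, `r' + δ ≤ R'`, `R' + 2δ ≤ R` the pair
`V' := U ∩ {r' ≤ |δx − z₀| ≤ R'}`, `S := U ∩ {R' < |δx − z₀| ≤ R' + δ}` is again a collar structure of the first
orientation at radii `(r', R')`, and `S` cuts `H` from `a` inside `Λ` (so `Avoid S ⊆ Avoid H`,
`avoid_subset_avoid_of_latticeCut`).  Same two closure arguments as the second orientation, radii reversed.

Only theorems; no named fact; axioms are the standard three.
-/

noncomputable section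

open Set Metric SimpleGraph
open Literature.Probability.LatticeModels
open Literature.Probability.RandomPlanarGeometry
open Summit.CriticalPhenomena.SAWScalingLimit.Theorems.FKGToTraversalBound.ExcursionDomination.KilledWalkCollar
  (abs_dist_sub_dist_le_of_adj joined_refl joined_trans mem_of_joined_left mem_of_joined_right joined_of_adj
    joined_of_mem_support mem_collar_of_adj_near)

namespace Summit.CriticalPhenomena.SAWScalingLimit.Theorems.FKGToTraversalBound.GatesByBubbleDoorsByFKG

/-- **SLIDING WINDOW, first orientation** (registered helper `stub_collarWindowOut` of STUB 4
`stub_collarAssembly`, crux stmt-CriticalPhenomena-1878).  Let `(V, H)` satisfy the collar clauses at radii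
`(r, R)` about `z₀` in the FIRST orientation (sites joined to `a` off `V` touch `V` only inside `r`; sites joined to
`H` off `V` touch `V` only beyond `R`), and let `U := {x ∈ Λ | x not joined to a off V}`.  For every window
`r + δ ≤ r'`, `r' + δ ≤ R'`, `R' + 2δ ≤ R`, the sets `V' := U ∩ {r' ≤ |δx − z₀| ≤ R'}` and
`S := U ∩ {R' < |δx − z₀| ≤ R' + δ}` satisfy: `(V', S)` fulfils the collar clauses at radii `(r', R')` about `z₀`,
again in the first orientation, and `S` CUTS `H` from `a` inside `Λ`.  Proof: `Near ∪ (U ∩ {< r'})` is stable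
under lattice steps inside `Λ` off `V'`, and `HJoined ∪ (U ∩ {> R' + δ})` is stable under steps inside `Λ` off
`S`. -/
theorem stub_collarWindowOut : ∀ (Λ : Finset (Site 2)) (a b : Site 2) (δ : ℝ) (z₀ : ℂ) (r R r' R' : ℝ) (H V : Finset (Site 2)), 0 < δ → CollarClauses Λ a b δ z₀ r R H V → (∀ x ∈ V, ∀ y ∈ Λ, y ∉ V → (zdGraph 2).Adj x y → (JoinedOff Λ V a y → dist (meshPoint δ y) z₀ < r) ∧ ((∃ h ∈ H, JoinedOff Λ V y h) → R < dist (meshPoint δ y) z₀)) → r + δ ≤ r' → r' + δ ≤ R' → R' + 2 * δ ≤ R → ∃ V' S : Finset (Site 2), (∀ x, x ∈ V' ↔ x ∈ Λ ∧ ¬ JoinedOff Λ V a x ∧ r' ≤ dist (meshPoint δ x) z₀ ∧ dist (meshPoint δ x) z₀ ≤ R') ∧ (∀ x, x ∈ S ↔ x ∈ Λ ∧ ¬ JoinedOff Λ V a x ∧ R' < dist (meshPoint δ x) z₀ ∧ dist (meshPoint δ x) z₀ ≤ R' + δ) ∧ CollarClauses Λ a b δ z₀ r' R' S V' ∧ (∀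 x ∈ V', ∀ y ∈ Λ, y ∉ V' → (zdGraph 2).Adj x y → (JoinedOff Λ V' a y → dist (meshPoint δ y) z₀ < r') ∧ ((∃ h ∈ S, JoinedOff Λ V' y h) → R' < dist (meshPoint δ y) z₀)) ∧ (∀ h ∈ H, ∀ q : (zdGraph 2).Walk a h, (∀ x ∈ q.support, x ∈ Λ) → ∃ x ∈ q.support, x ∈ S) := by
  classical
  intro Λ a b δ z₀ r R r' R' H V hδ hC hA h1 h2 h3
  obtain ⟨hVΛ, -, hab, hHnear, hHV, hbdry, -⟩ := hC
  -- abbreviations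
  set d : Site 2 → ℝ := fun x => dist (meshPoint δ x) z₀ with hd
  set Near : Site 2 → Prop := fun y => JoinedOff Λ V a y with hNear
  set V' : Finset (Site 2) := Λ.filter fun x => ¬ Near x ∧ r' ≤ d x ∧ d x ≤ R' with hV'
  set S : Finset (Site 2) := Λ.filter fun x => ¬ Near x ∧ R' < d x ∧ d x ≤ R' + δ with hS
  have memV' : ∀ x, x ∈ V' ↔ x ∈ Λ ∧ ¬ Near x ∧ r' ≤ d x ∧ d x ≤ R' := fun x => by
    rw [hV', Finset.mem_filter]
  have memS : ∀ x, x ∈ S ↔ x ∈ Λ ∧ ¬ Near x ∧ R' < d x ∧ d x ≤ R' + δ := fun x => by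
    rw [hS, Finset.mem_filter]
  -- basic facts
  have hstep : ∀ {x y : Site 2}, (zdGraph 2).Adj x y → |d y - d x| ≤ δ :=
    fun h => abs_dist_sub_dist_le_of_adj hδ z₀ h
  have hNa : Near a := by
    obtain ⟨p, hp⟩ := hab
    exact joined_refl (hp a p.start_mem_support)
  have hVU : ∀ x ∈ V, ¬ Near x := fun x hx hN => (mem_of_joined_right hN).2 hx
  -- a Near site adjacent to a collar site lies inside `r`
  have hnear : ∀ {v n : Site 2}, v ∈ V → (zdGraph 2).Adj v n → Near n → d n < r := by
    intro v n hv hadj hN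
    exact (hA v hv n (mem_of_joined_right hN).1 (mem_of_joined_right hN).2 hadj).1 hN
  -- a `Λ`-site off `Near` adjacent to a Near site is a collar site
  have hcol : ∀ {x y : Site 2}, x ∈ Λ → ¬ Near x → (zdGraph 2).Adj x y → Near y → x ∈ V :=
    fun hx hNx hadj hNy => mem_collar_of_adj_near hx hNx hadj hNy
  -- closure 1: `W := Near ∪ (U ∩ {< r'})` is stable under steps inside `Λ` off `V'`
  set W : Site 2 → Prop := fun y => Near y ∨ (y ∈ Λ ∧ ¬ Near y ∧ d y < r') with hW
  have hWstep : ∀ x y, W x → (zdGraph 2).Adj x y → (y ∈ Λ ∧ y ∉ V') → W y := by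
    rintro x y hx hadj ⟨hyΛ, hyV'⟩
    by_cases hNy : Near y
    · exact Or.inl hNy
    · right
      refine ⟨hyΛ, hNy, ?_⟩
      rcases hx with hNx | ⟨-, -, hrx⟩
      · have hyV : y ∈ V := hcol hyΛ hNy hadj.symm hNx
        have := hnear hyV hadj.symm hNx
        have hs := hstep hadj
        rw [abs_le] at hs
        linarith [hs.2]
      · have hs := hstep hadj
        rw [abs_le] at hs
        have hup : d y ≤ R' := by linarith [hs.2]
        by_contra hge
        push Not at hge
        exact hyV' ((memV' y).2 ⟨hyΛ, hNy, hge, hup⟩)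
  have hWwalk : ∀ {u v : Site 2} (p : (zdGraph 2).Walk u v), (∀ x ∈ p.support, x ∈ Λ ∧ x ∉ V') →
      W u → W v := fun p hp hu => walk_closed hWstep p hp hu
  have hWnotS : ∀ {y : Site 2}, W y → y ∉ S := by
    intro y hy hyS
    obtain ⟨-, hNy, hgt, -⟩ := (memS y).1 hyS
    rcases hy with hN | ⟨-, -, hlt⟩
    · exact hNy hN
    · linarith
  -- closure 2: `W₂ := HJoined ∪ (U ∩ {> R' + δ})` is stable under steps inside `Λ` off `S`
  set HJ : Site 2 → Prop := fun y => ∃ h ∈ H, JoinedOff Λ V y h with hHJ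
  set W₂ : Site 2 → Prop := fun y => HJ y ∨ (y ∈ Λ ∧ ¬ Near y ∧ R' + δ < d y) with hW₂
  have hW₂step : ∀ x y, W₂ x → (zdGraph 2).Adj x y → (y ∈ Λ ∧ y ∉ S) → W₂ y := by
    rintro x y hx hadj ⟨hyΛ, hyS⟩
    rcases hx with ⟨h, hh, hxh⟩ | ⟨hxΛ, hNx, hdx⟩
    · by_cases hyV : y ∈ V
      · right
        have hx' := mem_of_joined_left hxh
        have hgt : R < d x := (hA y hyV x hx'.1 hx'.2 hadj.symm).2 ⟨h, hh, hxh⟩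
        have hs := hstep hadj
        rw [abs_le] at hs
        exact ⟨hyΛ, hVU y hyV, by linarith [hs.1]⟩
      · exact Or.inl ⟨h, hh, joined_trans (joined_of_adj ⟨hyΛ, hyV⟩ (mem_of_joined_left hxh) hadj.symm) hxh⟩
    · right
      have hs := hstep hadj
      rw [abs_le] at hs
      have hdy : R' < d y := by linarith [hs.1]
      have hNy : ¬ Near y := by
        intro hNy
        have hxV : x ∈ V := hcol hxΛ hNx hadj hNy
        have := hnear hxV hadj hNy
        linarith
      refine ⟨hyΛ, hNy, ?_⟩
      by_contra hle
      push Not at hle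
      exact hyS ((memS y).2 ⟨hyΛ, hNy, hdy, hle⟩)
  -- the cut property
  have hcut : ∀ h ∈ H, ∀ q : (zdGraph 2).Walk a h, (∀ x ∈ q.support, x ∈ Λ) → ∃ x ∈ q.support, x ∈ S := by
    intro h hh q hq
    by_contra hno
    push Not at hno
    have hhΛ : h ∈ Λ := hq h q.end_mem_support
    have hhV : h ∉ V := fun hv => hHV h hv hh
    have hstart : W₂ h := Or.inl ⟨h, hh, joined_refl ⟨hhΛ, hhV⟩⟩
    have hend : W₂ a := walk_closed hW₂step q.reverse (fun x hx => by
      rw [Walk.support_reverse, List.mem_reverse] at hx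
      exact ⟨hq x hx, hno x hx⟩) hstart
    rcases hend with ⟨h', hh', hah'⟩ | ⟨-, hNa', -⟩
    · exact hHnear h' hah' hh'
    · exact hNa' hNa
  -- the orientation clause of the window structure
  have hA' : ∀ x ∈ V', ∀ y ∈ Λ, y ∉ V' → (zdGraph 2).Adj x y →
      (JoinedOff Λ V' a y → d y < r') ∧ ((∃ h ∈ S, JoinedOff Λ V' y h) → R' < d y) := by
    intro x hx y hyΛ hyV' hadj
    obtain ⟨hxΛ, hNx, -, -⟩ := (memV' x).1 hx
    constructor
    · intro hay
      obtain ⟨p, hp⟩ := hay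
      rcases hWwalk p hp (Or.inl hNa) with hNy | ⟨-, -, hlt⟩
      · exact lt_of_lt_of_le (hnear (hcol hxΛ hNx hadj hNy) hadj hNy) (by linarith)
      · exact hlt
    · rintro ⟨s, hs, ⟨p, hp⟩⟩
      by_contra hle
      push Not at hle
      have hWy : W y := by
        by_cases hNy : Near y
        · exact Or.inl hNy
        · refine Or.inr ⟨hyΛ, hNy, ?_⟩
          by_contra hge
          push Not at hge
          exact hyV' ((memV' y).2 ⟨hyΛ, hNy, hge, hle⟩)
      exact hWnotS (hWwalk p hp hWy) hs
  refine ⟨V', S, memV', memS, ⟨Finset.filter_subset _ _, ?_, ?_, ?_, ?_, ?_, Or.inl hA'⟩, hA', hcut⟩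
  · intro x hx
    obtain ⟨-, -, h₁, h₂⟩ := (memV' x).1 hx
    exact ⟨h₁, h₂⟩
  · obtain ⟨p, hp⟩ := hab
    refine ⟨p, fun x hx => ⟨(hp x hx).1, fun hxV' => ?_⟩⟩
    exact ((memV' x).1 hxV').2.1 (joined_of_mem_support p hp hx)
  · rintro y ⟨p, hp⟩
    exact hWnotS (hWwalk p hp (Or.inl hNa))
  · intro x hx hxS
    obtain ⟨-, -, -, h₁⟩ := (memV' x).1 hx
    obtain ⟨-, -, h₂, -⟩ := (memS x).1 hxS
    linarith
  · obtain ⟨p, hpΛ, hpd⟩ := hbdry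
    exact ⟨p, hpΛ, by linarith⟩

end Summit.CriticalPhenomena.SAWScalingLimit.Theorems.FKGToTraversalBound.GatesByBubbleDoorsByFKG

end
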